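import Mathlib.Analysis.InnerProductSpace.PiL2
import Mathlib.Analysis.Calculus.ContDiff.Basic
import Mathlib.Analysis.Calculus.Gradient.Basic
import Mathlib.Analysis.Calculus.Deriv.Basic
import Mathlib.Analysis.SpecialFunctions.Pow.Real
import Mathlib.Analysis.Complex.Basic
import HarnessLib

/-!
# Feldman–Salmhofer–Trubowitz III — regularity of interacting nonspherical Fermi surfaces: the full
# self-energy. §1: setting, hypotheses (H1)–(H5), (Sy), (H4), (H4'), and Theorems 1.1, 1.2

J. Feldman, M. Salmhofer, E. Trubowitz, *Regularity of interacting nonspherical Fermi surfaces: the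
full self-energy*, Comm. Pure Appl. Math. **52** (1999) 273–324 = arXiv:cond-mat/9705272 ("FST III";
FST I = J. Stat. Phys. 84 (1996) 1209 = arXiv:cond-mat/9509006 [FeldmanSalmhoferTrubowitz1996] (held:
`lit read paper:arxiv-cond-mat_9509006`), FST II = CPAM 51 (1998) 1133 = arXiv:cond-mat/9701073
[FeldmanSalmhoferTrubowitz1998] (typed in `FermiRG/FST2Hypotheses.lean`, `FermiRG/FST2Regularity.lean`),
FST IV = the inversion theorem, CPAM 53 (2000) 1350 = arXiv:math-ph/0001031 [FeldmanSalmhoferTrubowitz2000]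
(typed in `FermiRG/FSTInversion.lean`); the proved dictionary between this file's predicates and those of
`FST2Hypotheses.lean` is `FermiRG/FST3FST2Bridge.lean`).
STATEMENTS-FIRST typing (gate-hubbard-kl wave, rows FST3.T1.1 / FST3.T1.2): definitions and
`Prop`-valued statements only; NOTHING is asserted. Locators `p.N:Ln` = chunk `pNNNN.txt`, line `n`, of
the `lit read arxiv:cond-mat/9705272` TeX render (for (H4)/(H4') of `arxiv:cond-mat/9701073`); the
hypothesis LABELS, dropped by that render, were read on the PDF render of cond-mat/9705272v1 pp. 2–6.

* §0 Momentum space: "`𝓑 ⊂ ℝ^d` is a bounded region of momentum space (for example, the first Brillouin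
  zone)" (p.1); (H5) refers to "the fundamental domain `𝓕` of the action of the group `Γ` of the Fourier
  space lattice" (p.2:L4–7). As in FST IV §1.1 we take `𝓑 = ℝ^d/Γ^#` and model functions on `𝓑`
  (`ℝ × 𝓑`) as `Γ^#`-periodic functions on `Mom d = ℝ^d` (`Mom (d+1)`, coordinate `0` = `p₀`).
  Norms (1.1)–(1.2) `|f|_k`, `|f|_{k,h}` (`C^{k,0} := C^k`) as the PREDICATES `CkHolderNormLE k h f N`
  ("`|f|_{k,h} ≤ N`", through bounds of the partials and one Hölder constant — no `sSup` junk) and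
  `IsCkHolder k h f`. FLAG: the print has `sup_p Σ_α |D^α f(p)|`; we bound `Σ_α sup_p`, equivalent up
  to the factor `#{α : |α| ≤ k}` and immaterial for the existential constants below.
* §1 `Model d` (`Γ^#`, `𝓕`, `e`, `v̂`) and the hypotheses as predicates, verbatim: `H1 k h`, `H2 k h`,
  `H3`, `Sy`, `H5` (FST III p.1:L112–p.2:L7), `H4`, `H4' K_a` (FST II §2, "stated in Chapter 2 of II").
  Never instantiated at a concrete band: for `-2(cos p₁ + cos p₂) - μ` the print says (H5) "is
  fulfilled for densities `n < 0.369`" (FST II p.7:L121–124, a SUFFICIENCY statement, no converse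
  printed) — an identification NOT made here.
  CARRIER DELTA w.r.t. `FST2Hypotheses.lean` (same printed passages of FST II §2, typed concurrently by
  t4 over a `Crystal E` — a discrete `ℤ`-submodule `Γ#` of an inner-product space `E` with a fundamental
  domain of unique representatives — and a bare `e : E → ℝ`): here the carrier is the record `Model d`
  on `Mom d = EuclideanSpace ℝ (Fin d)` with `Γ^#` a bare `Set` and `𝓕` a bare `Set` (nothing enforced);
  the `C^{k,h}` classes are the coordinate-partial predicates `CkHolderNormLE`/`IsCkHolder` of FST III
  (1.1)–(1.2) (there: the tree's `MemContDiffHolder`, operator norms of `iteratedFDeriv`); (H4) quantifies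
  over PAIRS OF CURVES `(γ, a)` related pointwise by `Model.IsAntipode` (there: `HypA4`, an existential
  antipodal SELF-MAP of `S ∩ F` and curves in `S ∩ F`, `HasDerivAt`); the `d = 2` angular coordinate is
  `AngularChart` carrying the antipode FUNCTION `θ ↦ a(θ)` as data (there: `FermiCurveParam`, injective
  on a period, no antipode datum) and (H4') reads `∂a/∂θ` as `deriv` of that function with `K_a` an
  explicit parameter (there: `HypA4'`, `∂a/∂θ` := the curvature ratio `antipodeAngularDeriv` of
  (curvratio), `K_a` existential); (H5) over `M.fund` (there: `HypA5` over `cr.fundamentalDomain`). Where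
  the typings coincide LITERALLY this is proved in `FST3FST2Bridge.lean` (`fermiSurface_eq`, `hessQuad_eq`,
  `sy_iff_hypSy`, `h3_iff_hypA3`, `isAntipode_iff`, `Admits.geomConstants`); the rest is equivalent only up
  to these repackagings and is left to the consumer that fixes a crystal.
* §2 the constants "as regards … the statements of our theorems" (p.2:L16–41): `RegularityData`
  (`h`, `|e|_{2,h}`, `|v̂|_{2,h}`, `g₀`, `r₀`, `w₀`) and `Admits M c` (consequences (1), (3)).
* §3 THE OBJECTS NOT IN THE TREE: `K_r(e,V,·)` (coefficients of the counterterm function (1.5)) and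
  `Σ_r` ((1.6)) are renormalised `ε → 0` limits of scale-decomposed graph sums built in FST I §2–3
  [FeldmanSalmhoferTrubowitz1996] — the counterterm functional `𝒦^I = -ℓ Σ_{I≤i≤-1} 𝓔(C_i, 𝒢^I_{i+1})`
  defined "as a formal power series in `λ`" and `K^I(𝐩) = Σ_{r≥1} λ^r K^I_r(𝐩)` (FST I render
  `paper:arxiv-cond-mat_9509006` p0018:L136–p0019:L26), "the counterterms `K_r^I` are constructed
  recursively in `r`", `Σ` "the usual (Dyson) self-energy" (ibid. p0009:L6–16) — absent from the tree.
  They enter as BINDERS `K : Counterterm d`, `Sigma : SelfEnergy d` (GAP row G-t5-1 of the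
  gate-hubbard-kl GAP-LEDGER; source HELD, object not built); Theorems 1.1/1.2 are statement SCHEMAS `theorem11_i K`, …,
  `theorem12 d Sigma`, the facts of record being these schemas AT the FST I objects. No closed `Prop`
  is declared in their place (an `∃ K`/`∀ K` closure would be vacuous/false).
* §4 Theorem 1.1 (i)–(iii) (p.3:L19–65; the print numbers the `d ≥ 3` item a second "(ii)") and
  Theorem 1.2 (p.3:L87–93): `|K_r|_{2,h} ≤ 𝓒^r r!` digit-exact; `h ∈ [0,½)` (i), `(0,⅓)` (ii),
  `[0,h₀]` (iii); dependence lists typed as UNIFORMITY (`∃ 𝓒` after the data it may depend on,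
  before the model); `Σ_r ∈ C^{2,h}` only for `d ≥ 3`; in Theorem 1.2 `v̂ ∈ C^{1,γ}` but `e ∈ C^{2,0}`,
  `γ < 1` strict. Docstring-only remarks: `Σ₂ ∉ C²` in `d = 2` (p.3:L95–101); the `C^k` question
  (p.3:L143–148). §2–§3 of the paper (graph classification) are not typed here.

Typer lint: no `instance`, no `notation`, no attribute changes.
-/

noncomputable section

open scoped BigOperators

namespace Literature.MathematicalPhysics.QuantumLattice.FermiRG

namespace FST3

/-! ### §0 Momentum space, partial derivatives, the norms `|·|_k`, `|·|_{k,h}` (FST III (1.1), (1.2)) -/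

/-- Momentum space `ℝ^n` (spatial momenta `𝐩 ∈ ℝ^d`, or frequency–momentum `p = (p₀, 𝐩) ∈ ℝ × ℝ^d` with
`n = d + 1`, coordinate `0` = `p₀`). Functions on the Brillouin zone `𝓑 = ℝ^d/Γ^#` are modelled as
`Γ^#`-periodic functions on `Mom d` (FST IV §1.1). [cite: FeldmanSalmhoferTrubowitz1999, §1 p.1] -/
abbrev Mom (n : ℕ) : Type := EuclideanSpace ℝ (Fin n)

variable {n : ℕ} {F : Type*} [NormedAddCommGroup F] [NormedSpace ℝ F]

/-- The coordinate partial derivative `∂f/∂p_i` (as a Fréchet derivative in the direction of the `i`-th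
standard basis vector; junk value `0` where `f` is not differentiable).
[cite: FeldmanSalmhoferTrubowitz1999, §1 (1.1) p.1] -/
def partialD (i : Fin n) (f : Mom n → F) : Mom n → F :=
  fun p => fderiv ℝ f p (EuclideanSpace.single i (1 : ℝ))

/-- Iterated coordinate partials along a list of directions (outermost first).
[cite: FeldmanSalmhoferTrubowitz1999, §1 (1.1) p.1] -/
def iterPartial (l : List (Fin n)) (f : Mom n → F) : Mom n → F :=
  l.foldr (fun i g => partialD i g) f

/-- The order `|α| = Σ_i α_i` of a multi-index `α = (α_0, …, α_{n-1})`, `α_i ≥ 0`.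
[cite: FeldmanSalmhoferTrubowitz1999, §1 (1.1) p.1] -/
def miOrder (α : Fin n → ℕ) : ℕ := ∑ i, α i
/-- `D^α f = (∂/∂p_0)^{α_0} ⋯ (∂/∂p_{n-1})^{α_{n-1}} f` for a multi-index `α`
(coordinate order; for `C^{|α|}` functions the order is immaterial).
[cite: FeldmanSalmhoferTrubowitz1999, §1 (1.1) p.1] -/
def multiPartial (α : Fin n → ℕ) (f : Mom n → F) : Mom n → F :=
  iterPartial ((List.finRange n).flatMap fun i => List.replicate (α i) i) f

/-- The finite set of multi-indices `α` with `|α| ≤ k`. [cite: FeldmanSalmhoferTrubowitz1999, §1 (1.1) p.1] -/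
def multiIndicesLE (n k : ℕ) : Finset (Fin n → ℕ) :=
  ((Finset.univ : Finset (Fin n → Fin (k + 1))).image fun α i => (α i : ℕ)).filter
    fun α => miOrder α ≤ k

/-- `|f|_{k,h} ≤ N`, the norms (1.1)/(1.2) of FST III: `|f|_k = sup_p Σ_{|α|≤k} |D^α f(p)|` and, for
`0 < h ≤ 1`, `|f|_{k,h} = |f|_k-part + max_{|α|=k} sup_{x≠y} |D^α f(x) − D^α f(y)|/|x−y|^h`; "for
`h = 0`, we define `C^{k,0}(Ω) = C^k(Ω)`" (norm `|·|_k`). Typed without suprema: there are bounds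
`B α ≥ sup_p |D^α f(p)|` (`|α| ≤ k`) and, when `0 < h`, one Hölder constant `H` for all `D^α f`,
`|α| = k`, with `Σ_{|α|≤k} B α + H ≤ N` (for `h = 0` take `H = 0`). See the module docstring for the
`Σ sup` vs `sup Σ` remark. [cite: FeldmanSalmhoferTrubowitz1999, §1 (1.1)-(1.2) p.1] -/
def CkHolderNormLE (k : ℕ) (h : ℝ) (f : Mom n → F) (N : ℝ) : Prop :=
  ∃ B : (Fin n → ℕ) → ℝ, ∃ H : ℝ,
    (∀ α, miOrder α ≤ k → ∀ p, ‖multiPartial α f p‖ ≤ B α) ∧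
    0 ≤ H ∧
    (0 < h → ∀ α, miOrder α = k → ∀ x y : Mom n,
      ‖multiPartial α f x - multiPartial α f y‖ ≤ H * ‖x - y‖ ^ h) ∧
    (∑ α ∈ multiIndicesLE n k, B α) + H ≤ N

/-- `f ∈ C^{k,h}(ℝ^n, F)` in the sense of FST III §1: `f` is `C^k`, "with all derivatives of order at
most `k` uniformly bounded" and (for `0 < h`) `h`-Hölder continuous `k`-th derivatives, i.e.
`|f|_{k,h} < ∞`. [cite: FeldmanSalmhoferTrubowitz1999, §1 (1.2) p.1] -/
def IsCkHolder (k : ℕ) (h : ℝ) (f : Mom n → F) : Prop :=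
  ContDiff ℝ k f ∧ ∃ N : ℝ, CkHolderNormLE k h f N

/-- The frequency component `p₀` of `p = (p₀, 𝐩) ∈ ℝ × 𝓑`. [cite: FeldmanSalmhoferTrubowitz1999, §1 p.1] -/
def freq {d : ℕ} (q : Mom (d + 1)) : ℝ := q 0
/-- The spatial component `𝐩` of `p = (p₀, 𝐩)`. [cite: FeldmanSalmhoferTrubowitz1999, §1 p.1] -/
def spatial {d : ℕ} (q : Mom (d + 1)) : Mom d := WithLp.toLp 2 fun i => q i.succ

/-- `(p₀, 𝐩) ↦ (-p₀, 𝐩)`. [cite: FeldmanSalmhoferTrubowitz1999, §1 (H1) p.1] -/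
def freqReflect {d : ℕ} (q : Mom (d + 1)) : Mom (d + 1) :=
  WithLp.toLp 2 fun i => if i = 0 then -q 0 else q i
/-- `(p₀, 𝐩) ↦ (p₀, 𝐩 + γ)`: spatial translation. [cite: FeldmanSalmhoferTrubowitz1999, §1 p.1] -/
def spatialShift {d : ℕ} (γ : Mom d) (q : Mom (d + 1)) : Mom (d + 1) :=
  WithLp.toLp 2 (Fin.cons (q 0) fun i => q i.succ + γ i)

/-- The Hessian quadratic form `(t, e''(𝐩) t)` of a scalar function.
[cite: FeldmanSalmhoferTrubowitz1999, §1 p.2] -/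
def hessQuad {d : ℕ} (e : Mom d → ℝ) (p t : Mom d) : ℝ := iteratedFDeriv ℝ 2 e p ![t, t]

/-! ### §1 The model and the hypotheses (H1)–(H5), (Sy) of FST III §1; (H4), (H4') of FST II §2 -/

/-- The data of an FST model in `d` space dimensions: the Fourier-space (dual) lattice `Γ^#` acting on
momentum space by translations (the Brillouin zone is `𝓑 = ℝ^d/Γ^#`), a fundamental domain `𝓕` of that
action, "a band structure `e : 𝓑 → ℝ`" ("the energy … measured relative to the chemical potential", so
the Fermi surface is `S = {𝐩 : e(𝐩) = 0}`) and "an interaction `v̂ : ℝ × 𝓑 → ℂ, (p₀, 𝐩) ↦ v̂(p₀, 𝐩)`",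
"which has a small coupling constant `λ` in front" (FST III p.1:L70–95). Functions on `𝓑` are recorded
as `Γ^#`-periodic functions on `ℝ^d`. The structure does NOT enforce that `latt` is a lattice or that
`fund` is a fundamental domain (the statements below use them only through periodicity and (H5));
`d`, `e`, `v̂` are never instantiated in this file. [cite: FeldmanSalmhoferTrubowitz1999, §1 p.1] -/
structure Model (d : ℕ) where
  /-- the dual lattice `Γ^#` (translation vectors of momentum space) -/
  latt : Set (Mom d)
  /-- a fundamental domain `𝓕 ⊂ ℝ^d` of the action of `Γ^#` -/
  fund : Set (Mom d)
  /-- the band structure (dispersion relation minus the chemical potential) -/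
  e : Mom d → ℝ
  /-- the interaction `v̂(p₀, 𝐩)`, coordinate `0` of `Mom (d+1)` being `p₀` -/
  vhat : Mom (d + 1) → ℂ
  /-- `e` is a function on `𝓑 = ℝ^d/Γ^#` -/
  e_periodic : ∀ γ ∈ latt, ∀ p, e (p + γ) = e p
  /-- `v̂` is a function on `ℝ × 𝓑` -/
  vhat_periodic : ∀ γ ∈ latt, ∀ q, vhat (spatialShift γ q) = vhat q

variable {d : ℕ}

/-- The Fermi surface `S = {𝐩 : e(𝐩) = 0}` (as a `Γ^#`-periodic subset of `ℝ^d`).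
[cite: FeldmanSalmhoferTrubowitz1999, §1 p.1] -/
def Model.fermiSurface (M : Model d) : Set (Mom d) := M.e ⁻¹' {0}

/-- A function on `𝓑`, i.e. `Γ^#`-periodic. [cite: FeldmanSalmhoferTrubowitz1999, §1 p.1] -/
def Model.OnTorus (M : Model d) {G : Type*} (f : Mom d → G) : Prop := ∀ γ ∈ M.latt, ∀ p, f (p + γ) = f p

/-- **(H1)_{k,h}** (FST III p.1:L112–122): "`v̂ ∈ C^{k,h}(ℝ × 𝓑, ℂ)` with all derivatives of order at
most `k` uniformly bounded on `ℝ × 𝓑`, and `v̂` satisfies `v̂(-p₀, 𝐩) = \overline{v̂(p₀, 𝐩)}`. There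
is a bounded real-valued function `ṽ ∈ C^{k,h}(𝓑, ℝ)` such that `lim_{p₀ → ∞} v̂(p₀, 𝐩) = ṽ(𝐩)`.
The convergence is at rate `|p₀|^{-α}` uniformly in `𝐩` for some `α > 0`" (rate typed with the
constants of FST II §2, render p.7:L30–35: "there are `α > 0`, `K₀ > 0`, and `π₀ > 0` such that
`∀ |p₀| ≥ π₀ ∀ 𝐩 ∈ 𝓑: |v̂(p₀,𝐩) − ṽ(𝐩)| ≤ K₀ |p₀|^{-α}`"; by the reflection property and `ṽ` real the
two-sided and the printed one-sided `p₀ → ∞` forms agree). [cite: FeldmanSalmhoferTrubowitz1999, §1 (H1) p.1] -/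
def H1 (k : ℕ) (h : ℝ) (M : Model d) : Prop :=
  IsCkHolder k h M.vhat ∧
  (∀ q, M.vhat (freqReflect q) = star (M.vhat q)) ∧
  ∃ vtilde : Mom d → ℝ, M.OnTorus vtilde ∧ IsCkHolder k h vtilde ∧
    ∃ α K₀ π₀ : ℝ, 0 < α ∧ 0 < K₀ ∧ 0 < π₀ ∧ ∀ q : Mom (d + 1), π₀ ≤ abs (freq q) →
      ‖M.vhat q - (vtilde (spatial q) : ℂ)‖ ≤ K₀ * abs (freq q) ^ (-α)

/-- **(H2)_{k,h}** (FST III p.2:L1–2): "`e ∈ C^{k,h}(𝓑, ℝ)`, and `∇e(𝐩) ≠ 0` for all `𝐩 ∈ S`."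
[cite: FeldmanSalmhoferTrubowitz1999, §1 (H2) p.2] -/
def H2 (k : ℕ) (h : ℝ) (M : Model d) : Prop :=
  IsCkHolder k h M.e ∧ ∀ p ∈ M.fermiSurface, gradient M.e p ≠ 0

/-- **(H3)** (FST III p.2:L3): "The curvature of `S` is strictly positive everywhere", oriented so that
the Fermi sea `{e < 0}` is (locally) convex — the second fundamental form of the level set w.r.t.
`∇e`: `(t, e''(𝐩) t) > 0` for every non-zero tangent vector `t ⊥ ∇e(𝐩)`, `𝐩 ∈ S` (the sign is that of
consequence (3), p.2:L36–41, and of FST IV §1.2 (iv); in `d > 2` "meant in the matrix sense", FST II).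
[cite: FeldmanSalmhoferTrubowitz1999, §1 (H3) p.2] -/
def H3 (M : Model d) : Prop :=
  ∀ p ∈ M.fermiSurface, ∀ t : Mom d, t ≠ 0 → inner ℝ t (gradient M.e p) = 0 → 0 < hessQuad M.e p t

/-- **(Sy)** (FST III p.2:L44–46): "We call a band structure `e` symmetric if (Sy): for all `𝐩 ∈ 𝓑`,
`e(-𝐩) = e(𝐩)`, and asymmetric otherwise." [cite: FeldmanSalmhoferTrubowitz1999, §1 (Sy) p.2] -/
def Sy (M : Model d) : Prop := ∀ p, M.e (-p) = M.e p

/-- **(H5)**, the filling restriction (FST III p.2:L4–7): "The Fermi surface `S` is such that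
`{u𝐩 + v𝐪 : 𝐩, 𝐪 ∈ S, u, v = ±1} ⊂ 𝓕°`, where `𝓕` is the fundamental domain of the action of the group
`Γ` of the Fourier space lattice" (`S` read inside `𝓕`, `𝓕°` = interior). For the square-lattice band
`-2(cos p₁ + cos p₂) - μ` this "is fulfilled for densities `n < 0.369`" (FST II p.7:L121–124) — NOT
asserted here for any dispersion relation. [cite: FeldmanSalmhoferTrubowitz1999, §1 (H5) p.2] -/
def H5 (M : Model d) : Prop :=
  ∀ p ∈ M.fermiSurface, ∀ q ∈ M.fermiSurface, p ∈ M.fund → q ∈ M.fund →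
    ∀ u ∈ ({1, -1} : Set ℝ), ∀ v ∈ ({1, -1} : Set ℝ), u • p + v • q ∈ interior M.fund

/-- `𝐪` is the antipode `𝐚(𝐩)` of `𝐩 ∈ S`: the point of `S` whose unit normal `𝐧 = ∇e/|∇e|` is opposite
to that at `𝐩`, "`𝐧(𝐚(𝐩)) = -𝐧(𝐩)`" (FST III p.2:L52–55; unique under (H3), FST II p.7:L66–72).
Typed division-free as `|∇e(𝐩)| ∇e(𝐪) = -|∇e(𝐪)| ∇e(𝐩)`. GUARD (for consumers): this relation
DEGENERATES where a gradient vanishes — if `∇e(𝐩) = 0` or `∇e(𝐪) = 0` both sides are `0` and the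
relation holds for EVERY partner on `S` (see `Model.isAntipode_of_gradient_eq_zero`) — so it is the
printed antipode relation only at points with `∇e ≠ 0`, which is every point of `S` under (H2) (the
only points FST II/III consider); there it is EQUIVALENT to `unitNormal e 𝐪 = -unitNormal e 𝐩`, i.e. to
`FermiRG.IsAntipode` of `FST2Hypotheses.lean`: `FST3.isAntipode_iff` in `FermiRG/FST3FST2Bridge.lean`.
[cite: FeldmanSalmhoferTrubowitz1999, §1 p.2] -/
def Model.IsAntipode (M : Model d) (p q : Mom d) : Prop :=
  M.e p = 0 ∧ M.e q = 0 ∧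
    ‖gradient M.e p‖ • gradient M.e q = -(‖gradient M.e q‖ • gradient M.e p)

/-- **(H4)** (FST II §2, render p.7:L78–85; FST III p.2:L47–58 "(H4) requires that these two
curvature[s] must not differ by too much … where `too much' means a fixed number"): "In the asymmetric
case, we assume (H4): for all curves `t ↦ 𝐩(t)` in `S`,
`|1 − |∂𝐩(t)/∂t|^{-1} |∂𝐚(𝐩(t))/∂t|| ≤ 1/8`" — typed for every differentiable curve `γ` in `S` with
non-vanishing velocity and every differentiable curve `a` of antipodes `a(t) = 𝐚(γ(t))`. "If `e` is
symmetric, (H4) holds trivially" (ibid.). Cross-reference: `FermiRG.HypA4 cr e` (`FST2Hypotheses.lean`,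
same passage (upplo) p.7:L71–85) packages the antipode as ONE self-map `a` of `S ∩ F` (existentially
quantified) and the curves in `S ∩ F` with `HasDerivAt`; the present form is curve-pairwise on the
periodic lift `S` (carrier delta recorded in the module docstring; no literal equivalence claimed).
[cite: FeldmanSalmhoferTrubowitz1998, §2 (H4) p.7] -/
def H4 (M : Model d) : Prop :=
  ∀ γ a : ℝ → Mom d, (∀ t, M.IsAntipode (γ t) (a t)) →
    ∀ t, DifferentiableAt ℝ γ t → DifferentiableAt ℝ a t → deriv γ t ≠ 0 →
      abs (1 - ‖deriv a t‖ / ‖deriv γ t‖) ≤ 1 / 8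

/-- The angular coordinate of FST II §2.2 (`d = 2`): a `2π`-periodic `C¹` parametrisation
`θ ↦ 𝐩(0, θ)` of the Fermi curve by a multiple of arc length, "`|∂_θ 𝐩(0, θ)| = 1/P`" (render
p.9:L60–72), together with the antipodal map in that coordinate, "`∂_θ 𝐩(0, a(θ)) = -∂_θ 𝐩(0, θ)`"
(p.9:L80–84; so `a(θ) = θ + π` under (Sy)). Cross-reference: `FermiRG.FermiCurveParam cr e`
(`FST2Hypotheses.lean`, same passage p.9:L40–62) carries `(γ, dγ, P)` with `‖dγ‖ = P⁻¹`, `HasDerivAt`,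
injectivity on `[0, 2π)` and surjectivity onto `S ∩ F`, and NO antipode datum (its `∂a/∂θ` is the
curvature ratio (curvratio)); here `invP = 1/P`, `deriv` of a `Differentiable` curve, surjectivity onto
`S ∩ 𝓕`, no injectivity field, and the antipode FUNCTION `θ ↦ a(θ)` is part of the data (`antipode_spec`).
[cite: FeldmanSalmhoferTrubowitz1998, §2.2 p.9] -/
structure AngularChart (M : Model 2) where
  /-- `θ ↦ 𝐩(0, θ)` -/
  curve : ℝ → Mom 2
  /-- the antipodal map `θ ↦ a(θ)` in the angular coordinate -/
  antipode : ℝ → ℝ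
  /-- the constant speed `1/P > 0` -/
  invP : ℝ
  invP_pos : 0 < invP
  periodic : Function.Periodic curve (2 * Real.pi)
  onSurface : ∀ θ, M.e (curve θ) = 0
  surj : ∀ p ∈ M.fermiSurface, p ∈ M.fund → ∃ θ, curve θ = p
  differentiable : Differentiable ℝ curve
  speed : ∀ θ, ‖deriv curve θ‖ = invP
  antipode_differentiable : Differentiable ℝ antipode
  antipode_spec : ∀ θ, M.e (curve (antipode θ)) = 0 ∧ deriv curve (antipode θ) = -deriv curve θ

/-- **(H4')** with its constant `K_a` (FST II §2.3, render p.9:L110–123; `d = 2`, `e` asymmetric):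
"The function `∂a/∂θ` obeys `∂a/∂θ = 1` only at finitely many points `θ^{(1)}, …, θ^{(N)}`. There is
`δ₀ > 0` such that for all `k, l ≤ N`: if `k ≠ l`, `U_{2δ₀}(θ^{(k)}) ∩ U_{2δ₀}(θ^{(l)}) = ∅`, `∂a/∂θ` is
monotonic on `U_{2δ₀}(θ^{(k)})`, and there is a constant `K_a > 0` such that for all `k ≤ N` and all
`θ, θ' ∈ U_{δ₀}(θ^{(k)})`, `|∂a/∂θ(θ) − ∂a/∂θ(θ')| ≥ K_a |θ − θ'|`" (`U_δ` = open `δ`-neighbourhood;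
points `θ^{(k)}` are classes modulo `2π`, represented by the finite set `Θ ⊂ ℝ`; neighbourhoods are
taken around every representative). FST III Theorem 1.1 (ii): "`K_a` is defined in (H4')" — whence
`K_a` is an explicit PARAMETER here (the constant `𝓒₂` of `theorem11_ii` depends on it). Cross-reference:
`FermiRG.HypA4' e a Θ` (`FST2Hypotheses.lean`, same passage p.9:L127–139) states the same four clauses
with `∂a/∂θ :=` the curvature ratio `antipodeAngularDeriv e a Θ` ((curvratio) p.9:L117–123, equal to the
derivative of the angular antipode BY the printed computation, not by definition), the zero set as a
`Finset` inside `[0, 2π)` and `K_a` existential; here `∂a/∂θ := deriv A.antipode`.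
[cite: FeldmanSalmhoferTrubowitz1998, §2.3 (H4') p.9] -/
def H4' (M : Model 2) (Ka : ℝ) : Prop :=
  0 < Ka ∧ ∃ A : AngularChart M, ∃ Θ : Finset ℝ, ∃ δ₀ : ℝ, 0 < δ₀ ∧
    (∀ θ, deriv A.antipode θ = 1 ↔ ∃ θ₀ ∈ Θ, ∃ m : ℤ, θ = θ₀ + 2 * Real.pi * m) ∧
    (∀ θ₀ ∈ Θ, ∀ θ₁ ∈ Θ, θ₀ ≠ θ₁ → ∀ m : ℤ, 4 * δ₀ ≤ abs (θ₀ - θ₁ + 2 * Real.pi * m)) ∧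
    (∀ θ₀ ∈ Θ, ∀ m : ℤ, MonotoneOn (deriv A.antipode) (Metric.ball (θ₀ + 2 * Real.pi * m) (2 * δ₀)) ∨
      AntitoneOn (deriv A.antipode) (Metric.ball (θ₀ + 2 * Real.pi * m) (2 * δ₀))) ∧
    (∀ θ₀ ∈ Θ, ∀ m : ℤ, ∀ θ ∈ Metric.ball (θ₀ + 2 * Real.pi * m) δ₀,
      ∀ θ' ∈ Metric.ball (θ₀ + 2 * Real.pi * m) δ₀,
        Ka * abs (θ - θ') ≤ abs (deriv A.antipode θ - deriv A.antipode θ'))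

/-! ### §2 The constants `g₀, r₀, w₀` (FST III p.2:L16–41) and the dependence data of Theorem 1.1 -/

/-- The data the constants `𝓒₁, 𝓒₂, 𝓒₃` of Theorem 1.1 may depend on: "`h`, `|e|_{2,h}`, `|v̂|_{2,h}`,
`g₀`, `r₀`, and `w₀`" (p.3:L29–31, L43–45, L57–59; item (ii) adds `K_a`, item (iii) adds `d`).
[cite: FeldmanSalmhoferTrubowitz1999, Thm 1.1 p.3] -/
structure RegularityData where
  /-- the Hölder exponent `h` -/
  h : ℝ
  /-- a bound for `|e|_{2,h}` -/
  normE : ℝ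
  /-- a bound for `|v̂|_{2,h}` -/
  normV : ℝ
  /-- `g₀`: lower bound of `|∇e|` on `U_{r₀}` -/
  g₀ : ℝ
  /-- `r₀`: the width of the neighbourhood `U_{r₀} = {𝐩 : |e(𝐩)| < r₀}` of `S` -/
  r₀ : ℝ
  /-- `w₀`: lower bound of the tangential Hessian form on `U_{r₀}` -/
  w₀ : ℝ

/-- `M` admits the constants `c`: `|e|_{2,h} ≤ normE`, `|v̂|_{2,h} ≤ normV`, and the consequences of
(H2)_{2,h}, (H3) "as regards the constants that will appear in the statements of our theorems"
(p.2:L16–41): "there is a constant `r₀ > 0` such that in … `U_{r₀} = {𝐩 ∈ 𝓑 : |e(𝐩)| < r₀}` …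
(1) there is `g₀ > 0` such that for all `𝐩 ∈ U_{r₀}`, `|∇e(𝐩)| > g₀`; … (3) there is a constant
`w₀ > 0`, related to the minimal curvature `κ₀` in (H3), such that, e.g. in `d = 2`, for all
`𝐩 ∈ U_{r₀}`, `(∂_θ𝐩, e''(𝐩) ∂_θ𝐩) ≥ w₀`". NORMALISATION: the print evaluates the Hessian form on the
level-curve tangent `∂_θ𝐩` of the chart (2) (of constant length on `S`); we state it for every vector
`t ⊥ ∇e(𝐩)` with the factor `‖t‖²` (matrix sense in general `d`, as FST IV §1.2 (iv)), which changes
`w₀` by the fixed factor `|∂_θ𝐩|²` only. Consequence (2) (transversal field `u`, `u₀ = g₀/2`, and the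
`C^{2,h}` diffeomorphism `e(φ(ρ,θ)) = ρ`) introduces no further constant and is not re-typed.
[cite: FeldmanSalmhoferTrubowitz1999, §1 p.2] -/
def Admits (M : Model d) (c : RegularityData) : Prop :=
  CkHolderNormLE 2 c.h M.e c.normE ∧ CkHolderNormLE 2 c.h M.vhat c.normV ∧
  0 < c.r₀ ∧ 0 < c.g₀ ∧ 0 < c.w₀ ∧
  (∀ p, abs (M.e p) < c.r₀ → c.g₀ < ‖gradient M.e p‖) ∧
  (∀ p, abs (M.e p) < c.r₀ → ∀ t : Mom d, inner ℝ t (gradient M.e p) = 0 →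
    c.w₀ * ‖t‖ ^ 2 ≤ hessQuad M.e p t)

/-! ### §3 The objects of FST I that the tree does not construct (binders) -/

/-- BINDER TYPE for the counterterm coefficients: `K M r = K_r(e, V, ·) : 𝓑 → ℝ`, the order-`r`
coefficient of "the formal power series for `K`, `K(e, λV, 𝐩) = Σ_{r=1}^∞ λ^r K_r(e, V, 𝐩)`" (1.5),
`K_r` "a sum over values of graphs with `r` vertices" (p.3:L75–77), constructed in FST I
[FeldmanSalmhoferTrubowitz1996]: `K^I(𝐩) = Σ_{r≥1} K^I_r(𝐩) λ^r` at infrared cutoff `I`, defined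
recursively in `r` as a formal power series (render `paper:arxiv-cond-mat_9509006` p0008:L108–118 and
p0018:L136–p0019:L26), and `K_r = lim_{I→-∞} K^I_r` in `|·|₁`, `K_r ∈ C¹(𝓑, ℝ)` (ibid. p0008:L120–133,
item (iv)). NOT constructed in the tree: the theorems below are predicates in this binder (GAP G-t5-1,
see module docstring). [cite: FeldmanSalmhoferTrubowitz1999, §1 (1.5) p.3] -/
abbrev Counterterm (d : ℕ) : Type := Model d → ℕ → Mom d → ℝ

/-- BINDER TYPE for the self-energy coefficients: `Sigma M r = Σ_r : ℝ × 𝓑 → ℂ`, "the self energy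
`Σ(p) = Σ_{r=1}^∞ λ^r Σ_r(p)`" (1.6) — the infrared limit `Σ^I_r → Σ_r` in `|·|₁`,
`Σ_r ∈ C¹(ℝ × 𝓑, ℂ)`, of the renormalised expansion of FST I [FeldmanSalmhoferTrubowitz1996] (render
`paper:arxiv-cond-mat_9509006` p0008:L100–131, item (iii); "`Σ` is the usual (Dyson) self-energy",
p0009:L12–16). NOT constructed in the tree (GAP G-t5-1). [cite: FeldmanSalmhoferTrubowitz1999, §1 (1.6) p.3] -/
abbrev SelfEnergy (d : ℕ) : Type := Model d → ℕ → Mom (d + 1) → ℂ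

/-! ### §4 Theorem 1.1 (i), (ii), (iii) and Theorem 1.2 — statement schemas -/

/-- **Theorem 1.1 (i)** (FST III p.3:L19–31), as a statement about the counterterm coefficients `K`:
"Let `d = 2`. For all `h ∈ [0, ½)`: if (H1)_{2,h}, (H2)_{2,h}, (H3), (Sy), and (H5) hold, then there is
a constant `𝓒₁` such that for all `r ≥ 1`, `K_r ∈ C^{2,h}(𝓑, ℝ)`, and `|K_r|_{2,h} ≤ 𝓒₁^r r!` (1.7).
The constant `𝓒₁` depends only on `h`, `|e|_{2,h}`, `|v̂|_{2,h}`, `g₀`, `r₀`, and `w₀`. `h = 0` is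
allowed." "Depends only on" is typed as UNIFORMITY: `𝓒₁` is quantified after the data
`c = (h, |e|_{2,h}, |v̂|_{2,h}, g₀, r₀, w₀)` and before the model, and serves every model admitting `c`
(the reading the authors need "for an iteration of the map … the constants to be uniform on the set `𝓔`",
p.3:L67–73). The fact of record is this schema at the FST I counterterm (GAP).
[cite: FeldmanSalmhoferTrubowitz1999, Thm 1.1 (i) p.3] -/
def theorem11_i (K : Counterterm 2) : Prop :=
  ∀ c : RegularityData, 0 ≤ c.h → c.h < 1 / 2 →
    ∃ C₁ : ℝ, ∀ M : Model 2,
      H1 2 c.h M → H2 2 c.h M → H3 M → Sy M → H5 M → Admits M c →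
        ∀ r : ℕ, 1 ≤ r →
          M.OnTorus (K M r) ∧ IsCkHolder 2 c.h (K M r) ∧
            CkHolderNormLE 2 c.h (K M r) (C₁ ^ r * (r.factorial : ℝ))

/-- **Theorem 1.1 (ii)** (FST III p.3:L33–45): "Let `d = 2`. For all `h ∈ (0, ⅓)`: if (H1)_{2,h},
(H2)_{2,h}, (H3), (H4), (H4'), and (H5) hold, then there is a constant `𝓒₂` such that for all `r ≥ 1`,
`K_r ∈ C^{2,h}(𝓑, ℝ)`, and `|K_r|_{2,h} ≤ 𝓒₂^r r!` (1.8). The constant `𝓒₂` depends only on `h`,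
`|e|_{2,h}`, `|v̂|_{2,h}`, `g₀`, `r₀`, `K_a` and `w₀`. `h = 0` is not allowed. (`K_a` is defined in
(H4'))." [cite: FeldmanSalmhoferTrubowitz1999, Thm 1.1 (ii) p.3] -/
def theorem11_ii (K : Counterterm 2) : Prop :=
  ∀ c : RegularityData, ∀ Ka : ℝ, 0 < c.h → c.h < 1 / 3 →
    ∃ C₂ : ℝ, ∀ M : Model 2,
      H1 2 c.h M → H2 2 c.h M → H3 M → H4 M → H4' M Ka → H5 M → Admits M c →
        ∀ r : ℕ, 1 ≤ r →
          M.OnTorus (K M r) ∧ IsCkHolder 2 c.h (K M r) ∧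
            CkHolderNormLE 2 c.h (K M r) (C₂ ^ r * (r.factorial : ℝ))

/-- **Theorem 1.1 (iii)** (printed as a second "(ii)"; FST III p.3:L47–65): "Let `d ≥ 3`. There is
`h₀ > 0` such that for all `h ∈ [0, h₀]`: if (H1)_{2,h}, (H2)_{2,h}, (H3), and (H4) hold, then there is a
constant `𝓒₃` such that for all `r ≥ 1`, `K_r ∈ C^{2,h}(𝓑, ℝ)`, and `|K_r|_{2,h} ≤ 𝓒₃^r r!` (1.9). The
constant `𝓒₃` depends only on `d`, `h`, `|e|_{2,h}`, `|v̂|_{2,h}`, `g₀`, `r₀`, and `w₀`. `h = 0` is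
allowed. Moreover, there is a constant `𝓒₄` such that for all `r ≥ 1`, `Σ_r ∈ C^{2,h}(𝓑, ℝ)`, and
`|Σ_r|_{2,h} ≤ 𝓒₄^r r!` (1.10)." TYPING NOTES (flagged): `𝓒₄` carries no printed dependence list, so
it is quantified per model (weaker, implied by any uniform reading); (1.10) prints the space
`C^{2,h}(𝓑, ℝ)` for `Σ_r`, while (1.6)/Theorem 1.2 and the proof (§3, `|Val(G^J)|₂` over
`p ∈ ℝ × 𝓑`) treat `Σ_r` as a function on `ℝ × 𝓑` with values in `ℂ` — we type `Σ_r : ℝ × 𝓑 → ℂ` with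
the `C^{2,h}` norm on `ℝ × 𝓑`. [cite: FeldmanSalmhoferTrubowitz1999, Thm 1.1 (iii) p.3] -/
def theorem11_iii (d : ℕ) (K : Counterterm d) (Sigma : SelfEnergy d) : Prop :=
  3 ≤ d → ∃ h₀ : ℝ, 0 < h₀ ∧ ∀ c : RegularityData, 0 ≤ c.h → c.h ≤ h₀ →
    ∃ C₃ : ℝ, ∀ M : Model d,
      H1 2 c.h M → H2 2 c.h M → H3 M → H4 M → Admits M c →
        (∀ r : ℕ, 1 ≤ r →
          M.OnTorus (K M r) ∧ IsCkHolder 2 c.h (K M r) ∧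
            CkHolderNormLE 2 c.h (K M r) (C₃ ^ r * (r.factorial : ℝ))) ∧
        ∃ C₄ : ℝ, ∀ r : ℕ, 1 ≤ r →
          (∀ γ ∈ M.latt, ∀ q, Sigma M r (spatialShift γ q) = Sigma M r q) ∧
            IsCkHolder 2 c.h (Sigma M r) ∧
            CkHolderNormLE 2 c.h (Sigma M r) (C₄ ^ r * (r.factorial : ℝ))

/-- **Theorem 1.2** (FST III p.3:L87–93; "holds without the filling restriction (H5), and, for
asymmetric `e`, without the condition (H4')", p.3:L84–86): "Let `d ≥ 2` and `0 ≤ γ < 1`. If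
(H1)_{1,γ}, (H2)_{2,0}, (H3), and (H4) hold, then `Σ_r ∈ C^{1,γ}(ℝ × 𝓑, ℂ)` for all `r ≥ 1`. In
particular, if (H1)_{2,0}, (H2)_{2,0}, (H3), and (H4) hold, then `Σ_r ∈ C^{1,γ}(ℝ × 𝓑, ℂ)` for all
`γ < 1` and all `r ≥ 1`." Both clauses typed (conjunction); note the regularity asymmetry `v̂ ∈ C^{1,γ}`
vs `e ∈ C^{2,0}` ("our proof of the volume bound Theorem II.1.1 … requires `e ∈ C²`", p.3:L102–106)
and that `γ = 1` is excluded. REMARK (not a typed statement): "in two dimensions, `Σ₂` is not twice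
differentiable because of a logarithmic singularity in the second derivative, even for an `e ∈ C^∞` and
`v̂ = 1`" (p.3:L95–99) — a typed `Σ ∈ C²` claim in `d = 2` would contradict the source.
[cite: FeldmanSalmhoferTrubowitz1999, Thm 1.2 p.3] -/
def theorem12 (d : ℕ) (Sigma : SelfEnergy d) : Prop :=
  2 ≤ d →
    (∀ γ : ℝ, 0 ≤ γ → γ < 1 → ∀ M : Model d,
      H1 1 γ M → H2 2 0 M → H3 M → H4 M →
        ∀ r : ℕ, 1 ≤ r → IsCkHolder 1 γ (Sigma M r)) ∧
    (∀ M : Model d, H1 2 0 M → H2 2 0 M → H3 M → H4 M →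
      ∀ γ : ℝ, 0 ≤ γ → γ < 1 → ∀ r : ℕ, 1 ≤ r → IsCkHolder 1 γ (Sigma M r))

/-! ### §5 Sanity lemmas (definitional unfolding; nothing about the FST objects is claimed) -/

/-- A symmetric band structure has `-𝐩 ∈ S` whenever `𝐩 ∈ S` (immediate from (Sy)).
[cite: FeldmanSalmhoferTrubowitz1999, §1 (Sy) p.2] -/
theorem Sy.neg_mem {M : Model d} (hS : Sy M) {p : Mom d} (hp : p ∈ M.fermiSurface) :
    -p ∈ M.fermiSurface := by
  simp only [Model.fermiSurface, Set.mem_preimage, Set.mem_singleton_iff] at hp ⊢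
  rw [hS, hp]

/-- The antipode relation is symmetric in `𝐩, 𝐪`. [cite: FeldmanSalmhoferTrubowitz1999, §1 p.2] -/
theorem Model.IsAntipode.symm {M : Model d} {p q : Mom d} (h : M.IsAntipode p q) : M.IsAntipode q p := by
  obtain ⟨hp, hq, hpq⟩ := h
  refine ⟨hq, hp, ?_⟩
  rw [hpq, neg_neg]

/-- GUARD LEMMA (the degenerate case flagged in the docstring of `Model.IsAntipode`): where the gradient
vanishes the division-free antipode relation is vacuous — EVERY point of `S` is then an "antipode".
Consumers must therefore use `Model.IsAntipode` only together with (H2) (`∇e ≠ 0` on `S`), as FST II/III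
do; cf. `FST3.isAntipode_iff` (FST3FST2Bridge.lean). [cite: FeldmanSalmhoferTrubowitz1999, §1 (H2) p.2] -/
theorem Model.isAntipode_of_gradient_eq_zero {M : Model d} {p q : Mom d} (hp : p ∈ M.fermiSurface)
    (hq : q ∈ M.fermiSurface) (h0 : gradient M.e p = 0) : M.IsAntipode p q := by
  simp only [Model.fermiSurface, Set.mem_preimage, Set.mem_singleton_iff] at hp hq
  refine ⟨hp, hq, ?_⟩
  simp [h0]

/-- `|f|_{k,h} ≤ N` is monotone in `N`. [cite: FeldmanSalmhoferTrubowitz1999, §1 (1.2) p.1] -/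
theorem CkHolderNormLE.mono {k : ℕ} {h : ℝ} {f : Mom n → F} {N N' : ℝ}
    (hf : CkHolderNormLE k h f N) (hN : N ≤ N') : CkHolderNormLE k h f N' := by
  obtain ⟨B, H, hB, hH, hHol, hsum⟩ := hf
  exact ⟨B, H, hB, hH, hHol, hsum.trans hN⟩

end FST3

end Literature.MathematicalPhysics.QuantumLattice.FermiRG
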